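import Mathlib
import HarnessLib

/-!
# Coefficients against the `L¹`-norm of a polynomial on a box

(Line `janus-bands`, crux `ArrangementNormalForm`, stub `stub_separateTwoPos`, part
`NormEquiv`.) The finite-dimensional brick of the MONOMIAL SPLIT at a special point of the base
(numerator vanishing on the closed piece): for polynomials of bidegree `≤ (d, d)` every
coefficient is controlled by the `L¹`-norm on a fixed box, and — by rescaling — on the box
`[x, 4x] × [v, 4v]` with the natural weight:
`|c i j| x^i v^j · (x v) ≤ C ∫_{x}^{4x} ∫_{v}^{4v} |∑ c i' j' ξ^{i'} η^{j'}| dη dξ`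
(`SepTwo.coeff_le_box`, registered as `separateTwo_normEquiv`), with `C` depending on `d` only.
One variable (`SepTwo.exists_coeff_le_lone`): the `L¹`-seminorm `∫_a^b |∑ c j t^j| dt` is
continuous and positive on the unit sphere of the coefficient space (a polynomial vanishing on
`[a, b]` is zero), hence bounded below there by compactness; two variables by iterating.
Together with the averaging lemma of part `MonoSplit` this replaces the lower fibre-mass bounds
("placement") of the earlier roadmap: only UPPER comparisons of the weight towards the corner
are needed to split off every monomial of an absolutely convergent polynomial numerator.
-/

noncomputable section

open Set MeasureTheory intervalIntegral

namespace Summit.KontsevichZagierPeriods.ArrangementNormalForm.JanusBands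

namespace SepTwo

variable {d : ℕ}

/-- The polynomial function of degree `≤ d` with coefficient vector `c`. -/
def pev (c : Fin (d + 1) → ℝ) (t : ℝ) : ℝ := ∑ j, c j * t ^ (j : ℕ)

/-- The polynomial function of bidegree `≤ (d, d)` with coefficient matrix `c`. -/
def pev₂ (c : Fin (d + 1) → Fin (d + 1) → ℝ) (x v : ℝ) : ℝ :=
  ∑ i, ∑ j, c i j * x ^ (i : ℕ) * v ^ (j : ℕ)

/-- The `L¹`-seminorm of `pev c` on `[a, b]`. -/
def lone (a b : ℝ) (c : Fin (d + 1) → ℝ) : ℝ := ∫ t in a..b, |pev c t|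

/-- `pev` is jointly continuous in the coefficients and the variable. -/
theorem continuous_pev_uncurry :
    Continuous (Function.uncurry (fun (c : Fin (d + 1) → ℝ) (t : ℝ) => |pev c t|)) := by
  unfold pev Function.uncurry
  fun_prop

/-- `pev c` is continuous. -/
theorem continuous_pev (c : Fin (d + 1) → ℝ) : Continuous (pev c) := by
  unfold pev; fun_prop

/-- The `L¹`-seminorm is continuous in the coefficients. -/
theorem continuous_lone (a b : ℝ) : Continuous (lone (d := d) a b) :=
  intervalIntegral.continuous_parametric_intervalIntegral_of_continuous'
    (f := fun (c : Fin (d + 1) → ℝ) (t : ℝ) => |pev c t|) continuous_pev_uncurry a b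

/-- `pev` is linear in the coefficients: scalars. -/
theorem pev_smul (r : ℝ) (c : Fin (d + 1) → ℝ) (t : ℝ) : pev (r • c) t = r * pev c t := by
  unfold pev
  simp only [Pi.smul_apply, smul_eq_mul, Finset.mul_sum]
  refine Finset.sum_congr rfl fun j _ => by ring

/-- The `L¹`-seminorm is absolutely homogeneous. -/
theorem lone_smul (a b r : ℝ) (c : Fin (d + 1) → ℝ) : lone a b (r • c) = |r| * lone a b c := by
  unfold lone
  simp only [pev_smul, abs_mul]
  exact intervalIntegral.integral_const_mul _ _

/-- `pev c` is the evaluation of the polynomial `∑ C (c j) X^j`. -/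
theorem pev_eq_eval (c : Fin (d + 1) → ℝ) (t : ℝ) :
    pev c t = (∑ j : Fin (d + 1), Polynomial.C (c j) * Polynomial.X ^ (j : ℕ)).eval t := by
  simp [pev, Polynomial.eval_finsetSum]

/-- The coefficients of `∑ C (c j) X^j`. -/
theorem coeff_sum_eq (c : Fin (d + 1) → ℝ) (i : Fin (d + 1)) :
    (∑ j : Fin (d + 1), Polynomial.C (c j) * Polynomial.X ^ (j : ℕ)).coeff i = c i := by
  rw [Polynomial.finsetSum_coeff]
  simp only [Polynomial.coeff_C_mul_X_pow]
  rw [Finset.sum_eq_single i]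
  · simp
  · intro j _ hji
    rw [if_neg]
    exact fun h => hji (Fin.ext h.symm)
  · simp

/-- A coefficient vector whose polynomial vanishes on a nontrivial interval is zero. -/
theorem eq_zero_of_pev_eq_zero {a b : ℝ} (hab : a < b) (c : Fin (d + 1) → ℝ)
    (h : ∀ t ∈ Icc a b, pev c t = 0) : c = 0 := by
  set P : Polynomial ℝ := ∑ j : Fin (d + 1), Polynomial.C (c j) * Polynomial.X ^ (j : ℕ) with hP
  have hroots : P = 0 := by
    apply Polynomial.eq_zero_of_infinite_isRoot
    refine Set.Infinite.mono (s := Icc a b) (fun t ht => ?_) (Icc_infinite hab)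
    show P.IsRoot t
    rw [Polynomial.IsRoot.def, hP, ← pev_eq_eval]
    exact h t ht
  funext i
  rw [← coeff_sum_eq c i, ← hP, hroots]
  simp

/-- The `L¹`-seminorm on a nontrivial interval is definite. -/
theorem eq_zero_of_lone_eq_zero {a b : ℝ} (hab : a < b) (c : Fin (d + 1) → ℝ)
    (h : lone a b c = 0) : c = 0 := by
  by_contra hc
  have hex : ∃ t ∈ Icc a b, 0 < |pev c t| := by
    by_contra hall
    push Not at hall
    exact hc (eq_zero_of_pev_eq_zero hab c fun t ht => abs_nonpos_iff.1 (hall t ht))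
  have hpos : 0 < lone a b c :=
    intervalIntegral.integral_pos hab ((continuous_pev c).abs.continuousOn)
      (fun t _ => abs_nonneg _) hex
  exact hpos.ne' h

/-- **Norm equivalence, one variable.** Every coefficient is bounded by the `L¹`-norm on
`[a, b]`, with a constant depending only on `d`, `a`, `b`. -/
theorem exists_coeff_le_lone (d : ℕ) {a b : ℝ} (hab : a < b) :
    ∃ C : ℝ, 0 < C ∧ ∀ (c : Fin (d + 1) → ℝ) (i : Fin (d + 1)), |c i| ≤ C * lone a b c := by
  set S : Set (Fin (d + 1) → ℝ) := Metric.sphere 0 1 with hS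
  have hScpt : IsCompact S := isCompact_sphere 0 1
  have hSne : S.Nonempty := by
    refine ⟨Pi.single 0 1, ?_⟩
    rw [hS, mem_sphere_zero_iff_norm, Pi.norm_single, norm_one]
  obtain ⟨c₀, hc₀S, hmin⟩ := hScpt.exists_isMinOn hSne (continuous_lone a b).continuousOn
  set m := lone a b c₀ with hm
  have hm0 : 0 < m := by
    rcases (intervalIntegral.integral_nonneg hab.le (fun t _ => abs_nonneg (pev c₀ t))).lt_or_eq
      with hlt | heq
    · exact hlt
    · exfalso
      have h0 := eq_zero_of_lone_eq_zero hab c₀ heq.symm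
      rw [hS, mem_sphere_zero_iff_norm, h0, norm_zero] at hc₀S
      exact zero_ne_one hc₀S
  refine ⟨m⁻¹, inv_pos.2 hm0, fun c i => ?_⟩
  by_cases hc : c = 0
  · subst hc
    have : lone a b (0 : Fin (d + 1) → ℝ) = 0 := by
      have h := lone_smul a b 0 (0 : Fin (d + 1) → ℝ)
      rwa [zero_smul, abs_zero, zero_mul] at h
    simp [this]
  · have hn : 0 < ‖c‖ := norm_pos_iff.2 hc
    set u : Fin (d + 1) → ℝ := ‖c‖⁻¹ • c with hu
    have huS : u ∈ S := by
      rw [hS, mem_sphere_zero_iff_norm, hu, norm_smul, norm_inv, norm_norm, inv_mul_cancel₀ hn.ne']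
    have hcu : c = ‖c‖ • u := by
      rw [hu, smul_smul, mul_inv_cancel₀ hn.ne', one_smul]
    have hlone : lone a b c = ‖c‖ * lone a b u := by
      rw [hcu, lone_smul, abs_norm]; rw [← hcu]
    have hmu : m ≤ lone a b u := hmin huS
    have hci : |c i| ≤ ‖c‖ := by
      have := norm_le_pi_norm c i
      rwa [Real.norm_eq_abs] at this
    calc |c i| ≤ ‖c‖ := hci
      _ = m⁻¹ * (‖c‖ * m) := by field_simp
      _ ≤ m⁻¹ * (‖c‖ * lone a b u) := by gcongr
      _ = m⁻¹ * lone a b c := by rw [hlone]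

/-- `pev₂` as an iterated `pev`: first in `x` (coefficients `c · j`), then in `v`. -/
theorem pev₂_eq (c : Fin (d + 1) → Fin (d + 1) → ℝ) (x v : ℝ) :
    pev₂ c x v = pev (fun j => pev (fun i => c i j) x) v := by
  unfold pev₂ pev
  rw [Finset.sum_comm]
  simp only [Finset.sum_mul]

/-- `|pev₂ c|` is jointly continuous. -/
theorem continuous_pev₂_uncurry (c : Fin (d + 1) → Fin (d + 1) → ℝ) :
    Continuous (Function.uncurry (fun x v : ℝ => |pev₂ c x v|)) := by
  unfold pev₂ Function.uncurry
  fun_prop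

/-- `|pev₂ c x ·|` is continuous. -/
theorem continuous_pev₂_right (c : Fin (d + 1) → Fin (d + 1) → ℝ) (x : ℝ) :
    Continuous (fun v : ℝ => |pev₂ c x v|) := by
  unfold pev₂
  fun_prop

/-- **Norm equivalence, two variables** (iterated integral on a square). -/
theorem exists_coeff_le_lone₂ (d : ℕ) {a b : ℝ} (hab : a < b) :
    ∃ C : ℝ, 0 < C ∧ ∀ (c : Fin (d + 1) → Fin (d + 1) → ℝ) (i j : Fin (d + 1)),
      |c i j| ≤ C * ∫ x in a..b, ∫ v in a..b, |pev₂ c x v| := by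
  obtain ⟨C, hC, h⟩ := exists_coeff_le_lone d hab
  refine ⟨C * C, mul_pos hC hC, fun c i j => ?_⟩
  have h1 : |c i j| ≤ C * ∫ x in a..b, |pev (fun i' => c i' j) x| := h (fun i' => c i' j) i
  have h2 : ∀ x, |pev (fun i' => c i' j) x| ≤ C * ∫ v in a..b, |pev₂ c x v| := fun x => by
    have := h (fun j' => pev (fun i' => c i' j') x) j
    simpa only [lone, ← pev₂_eq] using this
  have hcont : Continuous fun x => C * ∫ v in a..b, |pev₂ c x v| :=
    continuous_const.mul
      (intervalIntegral.continuous_parametric_intervalIntegral_of_continuous'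
        (continuous_pev₂_uncurry c) a b)
  have h3 : ∫ x in a..b, |pev (fun i' => c i' j) x| ≤
      ∫ x in a..b, C * ∫ v in a..b, |pev₂ c x v| :=
    intervalIntegral.integral_mono_on hab.le
      ((continuous_pev _).abs.intervalIntegrable _ _) (hcont.intervalIntegrable _ _)
      fun x _ => h2 x
  calc |c i j| ≤ C * ∫ x in a..b, |pev (fun i' => c i' j) x| := h1
    _ ≤ C * ∫ x in a..b, C * ∫ v in a..b, |pev₂ c x v| :=
        mul_le_mul_of_nonneg_left h3 hC.le
    _ = C * C * ∫ x in a..b, ∫ v in a..b, |pev₂ c x v| := by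
        rw [intervalIntegral.integral_const_mul]; ring

/-- Rescaling the coefficients realises the dilation of the variables. -/
theorem pev₂_scale (c : Fin (d + 1) → Fin (d + 1) → ℝ) (x₀ v₀ ξ η : ℝ) :
    pev₂ c (x₀ * ξ) (v₀ * η) = pev₂ (fun i j => c i j * x₀ ^ (i : ℕ) * v₀ ^ (j : ℕ)) ξ η := by
  unfold pev₂
  refine Finset.sum_congr rfl fun i _ => Finset.sum_congr rfl fun j _ => ?_
  rw [mul_pow, mul_pow]
  ring

/-- Dilation of an iterated interval integral over a box. -/
theorem integral_box_scale (f : ℝ → ℝ → ℝ) {x₀ v₀ : ℝ} (hx : x₀ ≠ 0) (hv : v₀ ≠ 0) (a b : ℝ) :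
    ∫ ξ in x₀ * a..x₀ * b, ∫ η in v₀ * a..v₀ * b, f ξ η =
      x₀ * v₀ * ∫ ξ in a..b, ∫ η in a..b, f (x₀ * ξ) (v₀ * η) := by
  have hin : ∀ ξ, ∫ η in a..b, f ξ (v₀ * η) = v₀⁻¹ * ∫ η in v₀ * a..v₀ * b, f ξ η := fun ξ => by
    rw [intervalIntegral.integral_comp_mul_left (fun η => f ξ η) hv, smul_eq_mul]
  simp_rw [hin]
  rw [intervalIntegral.integral_comp_mul_left
      (fun ξ => v₀⁻¹ * ∫ η in v₀ * a..v₀ * b, f ξ η) hx, smul_eq_mul,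
    intervalIntegral.integral_const_mul]
  field_simp

/-- **Coefficients against the `L¹`-norm on the box `[x, 4x] × [v, 4v]`.** -/
theorem coeff_le_box (d : ℕ) : ∃ C : ℝ, 0 < C ∧
    ∀ (c : Fin (d + 1) → Fin (d + 1) → ℝ) (i j : Fin (d + 1)) (x v : ℝ), 0 < x → 0 < v →
      |c i j| * x ^ (i : ℕ) * v ^ (j : ℕ) * (x * v) ≤
        C * ∫ ξ in x..4 * x, ∫ η in v..4 * v, |pev₂ c ξ η| := by
  obtain ⟨C, hC, h⟩ := exists_coeff_le_lone₂ d (by norm_num : (1 : ℝ) < 4)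
  refine ⟨C, hC, fun c i j x v hx hv => ?_⟩
  have h1 := h (fun i' j' => c i' j' * x ^ (i' : ℕ) * v ^ (j' : ℕ)) i j
  have h2 : ∫ ξ in x..4 * x, ∫ η in v..4 * v, |pev₂ c ξ η| = x * v *
      ∫ ξ in (1 : ℝ)..4, ∫ η in (1 : ℝ)..4,
        |pev₂ (fun i' j' => c i' j' * x ^ (i' : ℕ) * v ^ (j' : ℕ)) ξ η| := by
    have := integral_box_scale (fun ξ η => |pev₂ c ξ η|) hx.ne' hv.ne' 1 4
    rw [mul_one, mul_one, mul_comm x 4, mul_comm v 4] at this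
    rw [this]
    simp only [pev₂_scale]
  have habs : |c i j * x ^ (i : ℕ) * v ^ (j : ℕ)| = |c i j| * x ^ (i : ℕ) * v ^ (j : ℕ) := by
    rw [abs_mul, abs_mul, abs_of_nonneg (pow_nonneg hx.le _), abs_of_nonneg (pow_nonneg hv.le _)]
  rw [h2, ← habs]
  have hxv : 0 ≤ x * v := (mul_pos hx hv).le
  calc |c i j * x ^ (i : ℕ) * v ^ (j : ℕ)| * (x * v)
      ≤ (C * ∫ ξ in (1 : ℝ)..4, ∫ η in (1 : ℝ)..4,
          |pev₂ (fun i' j' => c i' j' * x ^ (i' : ℕ) * v ^ (j' : ℕ)) ξ η|) * (x * v) :=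
        mul_le_mul_of_nonneg_right h1 hxv
    _ = _ := by ring

end SepTwo

/-- **Coefficients against the `L¹`-norm of a polynomial on a dilated box** (registered part of
`stub_separateTwoPos`; literal form of `SepTwo.coeff_le_box`): for every `d` there is `C > 0`
such that for all coefficient matrices `c` of bidegree `≤ (d, d)`, all `(i, j)` and all
`x, v > 0`, `|c i j| x^i v^j · (x v) ≤ C ∫_{x}^{4x} ∫_{v}^{4v} |∑ c i' j' ξ^{i'} η^{j'}| dη dξ`. -/
theorem separateTwo_normEquiv (d : ℕ) : ∃ C : ℝ, 0 < C ∧ ∀ (c : Fin (d + 1) → Fin (d + 1) → ℝ) (i j : Fin (d + 1)) (x v : ℝ), 0 < x → 0 < v → |c i j| * x ^ (i : ℕ) * v ^ (j : ℕ) * (x * v) ≤ C * ∫ ξ in x..4 * x, ∫ η in v..4 * v, |∑ i' : Fin (d + 1), ∑ j' : Fin (d + 1), c i' j' * ξ ^ (i' : ℕ) * η ^ (j' : ℕ)| := by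
  exact SepTwo.coeff_le_box d

end Summit.KontsevichZagierPeriods.ArrangementNormalForm.JanusBands
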